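import Literature.NumberTheory.EllipticCurves.CMNewformGamma0EulerFactorsPadicCharacter
import HarnessLib

/-!
# The MINIMAL print residue of `Ribet1977_cmNewform_gamma0_eulerFactor_padicCharacter`: ONLY the Euler factors of the `Γ₀` CM newform at the primes
# of `|d_K|·N𝔪`, through the `p`-adic character (Ribet 1977 §3 Remark (3.5), Miyake Thm. 4.6.17/4.8.2, Weil–Serre) — named fact

Topic `NumberTheory/EllipticCurves`; namespace `Literature.NumberTheory.EllipticCurves.ModularForms`. ONE named fact (D-0014, `def X : Prop`, cited): the conjunct
(BAD) of the two-conjunct residual fact `Ribet1977_cmNewform_gamma0_level_and_badEulerFactor_padicCharacter` (`CMNewformGamma0EulerFactorsPadicCharacterResidual.lean`),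
with VERBATIM the same binders. Its other conjunct (LEVEL) — `M ∣ |d_K|·N𝔪` — is now a THEOREM of the tree (`IsNewform0.level_dvd_discr_mul_absNorm_of_embCoeff`,
companion file `CMNewformGamma0LevelDvdProofs.lean`: Ribet's CM newform `Ribet1977_cmNewform_gamma0_of_isGrossencharakter_holds` + strong multiplicity one
`IsNewform0.level_eq_of_heckeEigenvalue_eq_holds` + the conjugate newform `GaloisConjugate.exists_isNewform0_conj`, all PROVED), and that file derives the two-conjunct
fact from THIS one (`Ribet1977_cmNewform_gamma0_level_and_badEulerFactor_padicCharacter_of_bad`), so citing consumers may re-key to the smaller print surface.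

* (BAD) — **the Euler factors at the primes `ℓ ∣ |d_K|·N𝔪`**, `ℓ ≠ p`: `1 − C(ι a_ℓ(g)) X + 𝟙_{ℓ∤M} C(ℓ) X² = ∏_{w ∋ ℓ, θ unram.} (1 − C(θ(Frob_w)₀₀) X^{f(w∣ℓ)})`.
  Ribet, LNM 601 (1977), §3 Remark (3.5) ("Shimura [26, p. 138] has pointed out that `g` is a newform if `𝔪` is the conductor of `ψ`" — so the newform is
  `Σ_{(𝔞,𝔣)=1} ψ₀(𝔞) q^{N𝔞}` for the primitive `ψ₀` of conductor `𝔣`, `L(f,s) = L(ψ₀,s)`; Miyake Thm. 4.8.2), the Euler product of a primitive form with `χ₀(ℓ) = 0`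
  at `ℓ ∣ N` (Miyake Thm. 4.6.17), and the `p`-adic character of `ψ₀` (Weil 1955; Serre 1968 Ch. II §2: unramified at `w ∤ p` iff `w ∤ 𝔣`, `Frob_w ↦ ψ₀(w)`; pinned by
  Chebotarev, Serre Ch. I §2.3).

Rendering: every binder is VERBATIM the residual fact's (see `CMNewformGamma0EulerFactorsPadicCharacter.lean` for the dictionary print ↔ tree); only the conclusion is cut
down to its second conjunct. NOT vendored: higher weight, non-trivial Nebentypus, `𝔣` and `ψ₀` as objects. -- TODO(general form): Ribet Thm. (3.4) in weight `k` on `Γ₁(DM)`.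
`lean search 'badEulerFactor|eulerFactor_padicCharacter'` (2026-08-31): the two sibling facts and the proofs files only.

## References
* K. A. Ribet, LNM 601 (1977), §3 Thm. (3.4), Cor. (3.5), Remark (3.5), pp. 34–35. [Ribet1977Nebentypus]
* T. Miyake, *Modular Forms* (1989/2006), Thm. 4.6.17, 4.8.2. [Miyake2006]
* J.-P. Serre, *Abelian ℓ-adic representations and elliptic curves* (1968), Ch. I §2.3, Ch. II §2. [SerreAbelianLadic1968]
-/

noncomputable section

open scoped NumberField ModularForm MatrixGroups
open NumberField IsDedekindDomain CongruenceSubgroup Polynomial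
open Literature.NumberTheory.GaloisRepresentations Literature.NumberTheory.LFunctions
  Literature.NumberTheory.Automorphic Literature.NumberTheory.EllipticCurves

namespace Literature.NumberTheory.EllipticCurves.ModularForms

/-- **The Euler factors of the `Γ₀` CM newform of `ψ` at the primes of `|d_K|·N𝔪`, through the `p`-adic character** (the (BAD) conjunct of
`Ribet1977_cmNewform_gamma0_level_and_badEulerFactor_padicCharacter`, same binders): for every prime `ℓ ∣ |d_K|·N𝔪`, `ℓ ≠ p`, every `Tℓ = {w ∋ ℓ : θ unramified at w}`,
arithmetic Frobenii `φ_w` and residue degrees `N(w) = ℓ^{f w}`: `1 − C(ι a_ℓ(g))·X + 𝟙_{ℓ∤M}·C(ℓ)·X² = ∏_{w∈Tℓ} (1 − C(θ(φ_w)₀₀)·X^{f w})` — the newform is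
`Σ_{(𝔞,𝔣)=1} ψ₀(𝔞) q^{N𝔞}` (Ribet Remark (3.5)/Shimura; Miyake Thm. 4.8.2), its Euler factors at `ℓ ∣ N` have `χ₀(ℓ) = 0` (Miyake Thm. 4.6.17), and the `p`-adic
character of `ψ₀` is unramified exactly off `p𝔣` with `Frob_w ↦ ψ₀(w)` (Serre 1968 Ch. II §2). [cite: Ribet1977Nebentypus, §3, Remark (3.5) (LNM 601, p. 35)]
[cite: Miyake2006, Thm. 4.6.17, Thm. 4.8.2] [cite: SerreAbelianLadic1968, Ch. I §2.3, Ch. II §2] -/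
def Ribet1977_cmNewform_gamma0_badEulerFactor_padicCharacter : Prop :=
  ∀ (K : Type) [Field K] [NumberField K], Module.finrank ℚ K = 2 → IsTotallyComplex K →
    ∀ (σ : K →+* ℂ) (𝔪 : Ideal (𝓞 K)), 𝔪 ≠ ⊥ →
    ∀ (ψ : HeightOneSpectrum (𝓞 K) → ℂ), IsGrossencharakter 𝔪 (embType σ) (embTypeConj σ) ψ →
      (∀ n : ℕ, Odd n → n.Coprime ((discr K).natAbs * Ideal.absNorm 𝔪) →
        idealPow K ψ (Ideal.span {(n : 𝓞 K)}) = (jacobiSym (discr K) n : ℂ) * (n : ℂ) ^ (2 - 1)) →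
    ∀ (p : ℕ) [Fact p.Prime] (e : PadicAlgCl p ≃+* ℂ) (M : ℕ) [NeZero M] (g : CuspForm (Gamma0 M) 2)
      (ι : coeffField g →+* PadicAlgCl p), IsNewform0 g →
      (∀ ℓ : ℕ, ℓ.Prime → ¬ ℓ ∣ (discr K).natAbs * Ideal.absNorm 𝔪 →
        embCoeff g ι ℓ = e.symm (∑ᶠ (w : HeightOneSpectrum (𝓞 K)) (_ : Ideal.absNorm w.asIdeal = ℓ), ψ w)) →
    ∀ (S : Set (PadicAlgCl p)) (θ : FramedGaloisRep K (padicCoeffIntegers S) 1),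
      (∀ w : HeightOneSpectrum (𝓞 K), ((p : ℕ) : 𝓞 K) ∉ w.asIdeal → ¬ 𝔪 ≤ w.asIdeal →
        θ.IsUnramifiedAt w ∧ ∃ P : Polynomial (padicCoeffIntegers S),
          P.map (padicCoeffIntegers S).subtype = X - C (e.symm (ψ w)) ∧ θ.HasFrobCharpolyAt w P) →
    ∀ (ℓ : ℕ), ℓ.Prime → ℓ ≠ p → ℓ ∣ (discr K).natAbs * Ideal.absNorm 𝔪 →
    ∀ (Tℓ : Finset (HeightOneSpectrum (𝓞 K))) (φ : HeightOneSpectrum (𝓞 K) → Field.absoluteGaloisGroup K) (f : HeightOneSpectrum (𝓞 K) → ℕ),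
      (∀ w, w ∈ Tℓ ↔ (((ℓ : ℕ) : 𝓞 K) ∈ w.asIdeal ∧ θ.IsUnramifiedAt w)) →
      (∀ w ∈ Tℓ, ∃ 𝔓 ∈ w.primesAbove, IsArithFrobAt (𝓞 K) (φ w) 𝔓) →
      (∀ w ∈ Tℓ, w.residueCard = ℓ ^ f w) →
      (1 - C (embCoeff g ι ℓ) * X + (if ℓ ∣ M then 0 else C ((ℓ : ℕ) : PadicAlgCl p)) * (X : (PadicAlgCl p)[X]) ^ 2) =
        ∏ w ∈ Tℓ, (1 - C ((((θ (φ w) : GL (Fin 1) (padicCoeffIntegers S)) : Matrix (Fin 1) (Fin 1) (padicCoeffIntegers S)) 0 0 :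
            padicCoeffIntegers S) : PadicAlgCl p) * (X : (PadicAlgCl p)[X]) ^ f w)

end Literature.NumberTheory.EllipticCurves.ModularForms

end
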